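import Mathlib.Algebra.Homology.Additive
import HarnessLib

/-!
# A complex whose terms admit a natural retraction of a unit `η : 𝟭 ⟶ F` is a retract of `F•` applied to it

Topic `Algebra/Homology`; namespace `Literature.Algebra.Homology`. Pure homological algebra (Weibel, *An
introduction to homological algebra* (1994), §1.2: chain maps are defined and composed degreewise; §2.6
Exercise 2.6.4: a natural transformation between additive functors induces a chain map on complexes term by
term). THEOREMS ONLY (the chain maps are exhibited inside the existential, with their components recorded as
equations); no definition, no named fact, no `sorry`.

SETTING. `C` a preadditive category, `F : C ⥤ C` a functor preserving zero morphisms, `η : 𝟭 C ⟶ F` a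
natural transformation (a «unit»), `P` a property of objects, and on the objects with `P` a RETRACTION of
the unit which is natural among them: morphisms `ρ_X : F X ⟶ X` (`P X`) with
`F φ ≫ ρ_Y = ρ_X ≫ φ` for `φ : X ⟶ Y` between objects with `P`, and `η_X ≫ ρ_X = 𝟙_X`.

* `exists_unitMap_mapHomologicalComplex` — the unit applied degreewise is a chain map `i : E ⟶ F•E`, `i_n = η_{E_n}`;
* `exists_retractionMap_mapHomologicalComplex` — for a complex all of whose terms satisfy `P`, the retraction applied
  degreewise is a chain map `r : F•E ⟶ E`, `r_n = ρ_{E_n}`;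
* **`exists_retract_mapHomologicalComplex`** — such a complex `E` is a RETRACT of `F•E`:
  `∃ (i : E ⟶ F•E) (r : F•E ⟶ E), (∀ n, i_n = η_{E_n}) ∧ (∀ n, r_n = ρ_{E_n}) ∧ i ≫ r = 𝟙 E`.

The instance this is written for (Hodge road №4, crux stmt-HodgeConjecture-26512, lens line N′, the parked
input (R) of `Summits/…/Theorems/VHCAbelianSchemesRoadExtJumpLocusLiftsOfRetract.lean`): `C = Mod(𝒪_Y)`,
`F = q^* ⋙ q_*` for a finite flat `q`, `η` the adjunction unit, `P` = «finite locally free», `ρ` = `(deg q)⁻¹ ·`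
(trace ⊗ 𝟙) — NOT constructed here; this file is the functorial bookkeeping only.

## References

* C. A. Weibel, *An introduction to homological algebra*, CUP (1994), §1.2 and Exercise 2.6.4. [Weibel1994]
* The Stacks Project, Tag 0BVH (the trace of a finite locally free morphism — the intended `ρ`). [StacksProject]
-/

noncomputable section

open CategoryTheory CategoryTheory.Category

namespace Literature.Algebra.Homology

universe v u

variable {C : Type u} [Category.{v} C] [Preadditive C] (F : C ⥤ C) [F.PreservesZeroMorphisms] (η : 𝟭 C ⟶ F)
  {ι : Type*} {c : ComplexShape ι}

/-- **The unit on a complex**: `η` applied degreewise is a chain map `E ⟶ F•E` (naturality of `η`).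
[cite: Weibel1994, §1.2 and Exercise 2.6.4] -/
theorem exists_unitMap_mapHomologicalComplex (E : HomologicalComplex C c) :
    ∃ i : E ⟶ (F.mapHomologicalComplex c).obj E, ∀ n, i.f n = η.app (E.X n) :=
  ⟨{ f := fun n => η.app (E.X n),
      comm' := fun n m _ => by
        have h := η.naturality (E.d n m)
        rw [Functor.id_map] at h
        exact h.symm }, fun _ => rfl⟩

variable (P : C → Prop) (ρ : ∀ X, P X → (F.obj X ⟶ X))

/-- **The retraction on a complex**: `ρ` applied degreewise to a complex whose terms all satisfy `P` is a chain map
`F•E ⟶ E` (naturality of `ρ` among `P`-objects). [cite: Weibel1994, §1.2 and Exercise 2.6.4] -/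
theorem exists_retractionMap_mapHomologicalComplex
    (hnat : ∀ {X Y : C} (hX : P X) (hY : P Y) (φ : X ⟶ Y), F.map φ ≫ ρ Y hY = ρ X hX ≫ φ)
    (E : HomologicalComplex C c) (hE : ∀ n, P (E.X n)) :
    ∃ r : (F.mapHomologicalComplex c).obj E ⟶ E, ∀ n, r.f n = ρ (E.X n) (hE n) :=
  ⟨{ f := fun n => ρ (E.X n) (hE n),
      comm' := fun n m _ => (hnat (hE n) (hE m) (E.d n m)).symm }, fun _ => rfl⟩

/-- **A complex whose terms carry a natural retraction of the unit is a retract of `F•` of itself**: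
`∃ (i : E ⟶ F•E) (r : F•E ⟶ E), i_n = η_{E_n} ∧ r_n = ρ_{E_n} ∧ i ≫ r = 𝟙 E`.
[cite: Weibel1994, §1.2 and Exercise 2.6.4] [cite: StacksProject, Tag 0BVH] -/
theorem exists_retract_mapHomologicalComplex
    (hnat : ∀ {X Y : C} (hX : P X) (hY : P Y) (φ : X ⟶ Y), F.map φ ≫ ρ Y hY = ρ X hX ≫ φ)
    (hsplit : ∀ (X : C) (hX : P X), η.app X ≫ ρ X hX = 𝟙 X)
    (E : HomologicalComplex C c) (hE : ∀ n, P (E.X n)) :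
    ∃ (i : E ⟶ (F.mapHomologicalComplex c).obj E) (r : (F.mapHomologicalComplex c).obj E ⟶ E),
      (∀ n, i.f n = η.app (E.X n)) ∧ (∀ n, r.f n = ρ (E.X n) (hE n)) ∧ i ≫ r = 𝟙 E := by
  obtain ⟨i, hi⟩ := exists_unitMap_mapHomologicalComplex F η E
  obtain ⟨r, hr⟩ := exists_retractionMap_mapHomologicalComplex F P ρ hnat E hE
  refine ⟨i, r, hi, hr, ?_⟩
  ext n
  rw [HomologicalComplex.comp_f, hi, hr, HomologicalComplex.id_f]
  exact hsplit (E.X n) (hE n)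

end Literature.Algebra.Homology
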